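import Summits.ValiantsHypothesis.ValiantsHypothesis.Theorems.LacunarySymmetroidMatrixDescartesCensusDoorA34SheetHyperbolicIsotropic
import Summits.ValiantsHypothesis.ValiantsHypothesis.Theorems.LacunarySymmetroidMatrixDescartesCensusDoorA34SheetIsotropicPlane

/-!
# `MatrixDescartes` census — DOOR A at `(3,4)`: the hyperbolic graft calculus AT THE ROOTS of a null-top `(3,4)` pencil — root-level
# window split, root-free zone, type law and ODD-CROSSING LAW in the line's currency (`Σ_l x^{d_l} S_l`, top letter `h·(vwᵀ + wvᵀ)`)

HONEST FRAMING.  Object-search cell `pub-symmetroid`, engine seat `val-sym-eng-2` (g7); helper row beside the registered strata line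
`Cruxes/DoorA34/Lines/strata.lean` on stmt-ValiantsHypothesis-19980 (`DoorA34 = PosRootLawAt 3 4 18`: OPEN, typed, never asserted here), stub
`stub_nullTopCeiling`, INDEFINITE cell.  …SheetHyperbolicGraft / …SheetHyperbolicIsotropic proved the calculus for matrices; this file evaluates it
on the pencil `F(x) = Σ_{l<4} x^{d_l} S_l` with symmetric letters and hyperbolic top letter `S₃ = h·(vwᵀ + wvᵀ)` (core `G(x) = Σ_{l<3} x^{d_l} S_l`,
`k = v × w`, `q_u(x) = uᵀ adj G(x) u`, `m(x) = vᵀ adj G(x) w`, `T(x) = kᵀ G(x) k`):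

* `pencil_eval_eq_core_add_hyperbolic` — `F(x) = G(x) + (x^{d₃}·h)·(vwᵀ + wvᵀ)`;
* `det_pencil_eval_hyperbolic` — **ROOT-LEVEL WINDOW SPLIT** `det F(x) = det G(x) + (x^{d₃}h)·2m(x) − (x^{d₃}h)²·T(x)`;
* `hyperbolic_sheet_identity_eval` — `T(x)·det F(x) = q_v(x)·q_w(x) − (m(x) − x^{d₃}h·T(x))²`;
* `quadForm_adjugate_mul_nonneg_at_pencil_root` / `det_pencil_ne_zero_of_quadForm_mul_neg` — at every real det-root the two rank-one compressions
  OF THE CORE have the same sign; where `q_v·q_w < 0` the sheet pencil has no root, for every `h` (**ROOT-FREE ZONE**, chart-free);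
* `quadForm_adjugate_core_nonpos_of_type_neg` — at a det-root of TYPE `(−)` (`tr adj F(r) < 0`, the census's middle-eigenvalue roots) both
  `q_v(r) ≤ 0` and `q_w(r) ≤ 0` (the graft does not move them; coordinate-free type law);
* `quadForm_adjugate_core_nonpos_at_top_root` — at a root `z` of the top trinomial (`T(z) = 0`, `k ≠ 0`) both `q_v(z) ≤ 0` and `q_w(z) ≤ 0`;
* `hyperbolic_odd_crossing_law_pencil` — **ODD-CROSSING LAW** for the sheet pencil: between a type-`(−)` det-root `r` and a top-trinomial root `z`,
  `0 ≤ q_v(r)·q_v(z)` and `0 ≤ q_w(r)·q_w(z)` — neither rank-one compression of the core changes sign an odd number of times.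

Located reading (seat report HOME/DOOR-A34-ENG2G7-REPORT.md): these are the exact sign rows under the located INDEFINITE WINDOW LAW; they do not
bound the count.  `DoorA34` and the three stubs stay OPEN; registers unchanged; nothing on `MatrixDescartes` (stmt-ValiantsHypothesis-18050) or
`VP ≠ VNP` — VP≠VNP not moved.  [folklore] evaluation of the matrix identities of …SheetHyperbolicGraft; elementary.
-/

-- `Summit.ValiantsHypothesis.ValiantsHypothesis.…` repeats a component by the D-0017 layout
-- (single-conjunct summit), which the `dupNamespace` linter flags; the name is mandated.
set_option linter.dupNamespace false

namespace Summit.ValiantsHypothesis.ValiantsHypothesis.Theorems.LacunarySymmetroidMatrixDescartes.Census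

open Polynomial Finset
open scoped BigOperators Polynomial Matrix
open Matrix

/-! ## 1. The evaluated pencil splits into core + hyperbolic graft -/

/-- `F(x) = G(x) + (x^{d₃}·h)·(vwᵀ + wvᵀ)` for the top letter `S₃ = h·(vwᵀ + wvᵀ)`. [folklore] -/
theorem pencil_eval_eq_core_add_hyperbolic (d : Fin 4 → ℕ) (S : Fin 4 → Matrix (Fin 3) (Fin 3) ℝ) (h : ℝ) (v w : Fin 3 → ℝ)
    (hS3 : S 3 = h • (Matrix.vecMulVec v w + Matrix.vecMulVec w v)) (x : ℝ) :
    (∑ l, x ^ d l • S l)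
      = (∑ l : Fin 3, x ^ d (Fin.castSucc l) • S (Fin.castSucc l)) + (x ^ d 3 * h) • (Matrix.vecMulVec v w + Matrix.vecMulVec w v) := by
  rw [Fin.sum_univ_castSucc, mul_smul]
  congr 1
  change x ^ d 3 • S 3 = _
  rw [hS3]

/-- The core of a pencil with symmetric letters is symmetric at every `x`. [folklore] -/
theorem isSymm_core_eval (d : Fin 4 → ℕ) (S : Fin 4 → Matrix (Fin 3) (Fin 3) ℝ) (hS : ∀ l, (S l).IsSymm) (x : ℝ) :
    (∑ l : Fin 3, x ^ d (Fin.castSucc l) • S (Fin.castSucc l)).IsSymm :=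
  isSymm_pencil_eval (fun l : Fin 3 => d (Fin.castSucc l)) (fun l => hS (Fin.castSucc l)) x

/-- **ROOT-LEVEL WINDOW SPLIT**: `det F(x) = det G(x) + (x^{d₃}h)·2·vᵀadj G(x) w − (x^{d₃}h)²·kᵀG(x)k` (symmetric letters). [folklore] -/
theorem det_pencil_eval_hyperbolic (d : Fin 4 → ℕ) (S : Fin 4 → Matrix (Fin 3) (Fin 3) ℝ) (hS : ∀ l, (S l).IsSymm) (h : ℝ)
    (v w : Fin 3 → ℝ) (hS3 : S 3 = h • (Matrix.vecMulVec v w + Matrix.vecMulVec w v)) (x : ℝ) :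
    (∑ l, x ^ d l • S l).det
      = (∑ l : Fin 3, x ^ d (Fin.castSucc l) • S (Fin.castSucc l)).det
        + (x ^ d 3 * h) * (2 * (v ⬝ᵥ ((∑ l : Fin 3, x ^ d (Fin.castSucc l) • S (Fin.castSucc l)).adjugate *ᵥ w)))
        - (x ^ d 3 * h) ^ 2 * ((v ⨯₃ w) ⬝ᵥ ((∑ l : Fin 3, x ^ d (Fin.castSucc l) • S (Fin.castSucc l)) *ᵥ (v ⨯₃ w))) := by
  rw [pencil_eval_eq_core_add_hyperbolic d S h v w hS3 x, det_add_smul_hyperbolic_fin_three,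
    ← adjugate_bilin_symm _ (isSymm_core_eval d S hS x) v w]
  ring

/-- **SHEET IDENTITY at `x`**: `T(x)·det F(x) = q_v(x)·q_w(x) − (m(x) − x^{d₃}h·T(x))²`. [folklore] -/
theorem hyperbolic_sheet_identity_eval (d : Fin 4 → ℕ) (S : Fin 4 → Matrix (Fin 3) (Fin 3) ℝ) (hS : ∀ l, (S l).IsSymm) (h : ℝ)
    (v w : Fin 3 → ℝ) (hS3 : S 3 = h • (Matrix.vecMulVec v w + Matrix.vecMulVec w v)) (x : ℝ) :
    ((v ⨯₃ w) ⬝ᵥ ((∑ l : Fin 3, x ^ d (Fin.castSucc l) • S (Fin.castSucc l)) *ᵥ (v ⨯₃ w))) * (∑ l, x ^ d l • S l).det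
      = (v ⬝ᵥ ((∑ l : Fin 3, x ^ d (Fin.castSucc l) • S (Fin.castSucc l)).adjugate *ᵥ v))
          * (w ⬝ᵥ ((∑ l : Fin 3, x ^ d (Fin.castSucc l) • S (Fin.castSucc l)).adjugate *ᵥ w))
        - (v ⬝ᵥ ((∑ l : Fin 3, x ^ d (Fin.castSucc l) • S (Fin.castSucc l)).adjugate *ᵥ w)
            - (x ^ d 3 * h) * ((v ⨯₃ w) ⬝ᵥ ((∑ l : Fin 3, x ^ d (Fin.castSucc l) • S (Fin.castSucc l)) *ᵥ (v ⨯₃ w)))) ^ 2 := by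
  rw [pencil_eval_eq_core_add_hyperbolic d S h v w hS3 x]
  exact hyperbolic_sheet_identity _ (isSymm_core_eval d S hS x) _ v w

/-! ## 2. Sign rows at the roots -/

/-- **Same sign of the two rank-one core compressions at every det-root** (symmetric letters, hyperbolic top letter, every `h`). [folklore] -/
theorem quadForm_adjugate_mul_nonneg_at_pencil_root (d : Fin 4 → ℕ) (S : Fin 4 → Matrix (Fin 3) (Fin 3) ℝ) (hS : ∀ l, (S l).IsSymm)
    (h : ℝ) (v w : Fin 3 → ℝ) (hS3 : S 3 = h • (Matrix.vecMulVec v w + Matrix.vecMulVec w v)) {r : ℝ}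
    (hr : (Matrix.det (∑ l, ((X : ℝ[X]) ^ d l) • (S l).map C)).IsRoot r) :
    0 ≤ (v ⬝ᵥ ((∑ l : Fin 3, r ^ d (Fin.castSucc l) • S (Fin.castSucc l)).adjugate *ᵥ v))
        * (w ⬝ᵥ ((∑ l : Fin 3, r ^ d (Fin.castSucc l) • S (Fin.castSucc l)).adjugate *ᵥ w)) := by
  have hdet := det_pencil_eval_eq_zero_of_isRoot d S hr
  rw [pencil_eval_eq_core_add_hyperbolic d S h v w hS3 r] at hdet
  exact quadForm_adjugate_mul_nonneg_at_hyperbolic_root _ (isSymm_core_eval d S hS r) _ v w hdet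

/-- **ROOT-FREE ZONE for the sheet pencil**: where `q_v(x)·q_w(x) < 0` the determinant does not vanish — for every `h`. [folklore] -/
theorem det_pencil_ne_zero_of_quadForm_mul_neg (d : Fin 4 → ℕ) (S : Fin 4 → Matrix (Fin 3) (Fin 3) ℝ) (hS : ∀ l, (S l).IsSymm)
    (h : ℝ) (v w : Fin 3 → ℝ) (hS3 : S 3 = h • (Matrix.vecMulVec v w + Matrix.vecMulVec w v)) {x : ℝ}
    (hneg : (v ⬝ᵥ ((∑ l : Fin 3, x ^ d (Fin.castSucc l) • S (Fin.castSucc l)).adjugate *ᵥ v))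
        * (w ⬝ᵥ ((∑ l : Fin 3, x ^ d (Fin.castSucc l) • S (Fin.castSucc l)).adjugate *ᵥ w)) < 0) :
    (∑ l, x ^ d l • S l).det ≠ 0 := by
  rw [pencil_eval_eq_core_add_hyperbolic d S h v w hS3 x]
  exact det_hyperbolic_ne_zero_of_quadForm_mul_neg _ (isSymm_core_eval d S hS x) _ v w hneg

/-- **TYPE `(−)` ⇒ both rank-one core compressions `≤ 0`** at a det-root `r` with `tr adj F(r) < 0`. [folklore] -/
theorem quadForm_adjugate_core_nonpos_of_type_neg (d : Fin 4 → ℕ) (S : Fin 4 → Matrix (Fin 3) (Fin 3) ℝ) (hS : ∀ l, (S l).IsSymm)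
    (h : ℝ) (v w : Fin 3 → ℝ) (hS3 : S 3 = h • (Matrix.vecMulVec v w + Matrix.vecMulVec w v)) {r : ℝ}
    (hr : (Matrix.det (∑ l, ((X : ℝ[X]) ^ d l) • (S l).map C)).IsRoot r) (htype : (∑ l, r ^ d l • S l).adjugate.trace < 0) :
    v ⬝ᵥ ((∑ l : Fin 3, r ^ d (Fin.castSucc l) • S (Fin.castSucc l)).adjugate *ᵥ v) ≤ 0
      ∧ w ⬝ᵥ ((∑ l : Fin 3, r ^ d (Fin.castSucc l) • S (Fin.castSucc l)).adjugate *ᵥ w) ≤ 0 := by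
  have hdet := det_pencil_eval_eq_zero_of_isRoot d S hr
  have hsymF := isSymm_pencil_eval d hS r
  rw [pencil_eval_eq_core_add_hyperbolic d S h v w hS3 r] at hdet hsymF htype
  refine ⟨?_, ?_⟩
  · rw [← adjugate_quadForm_hyperbolic_left _ (r ^ d 3 * h) v w]
    exact quadForm_adjugate_nonpos_of_trace_adjugate_neg _ hsymF hdet htype v
  · rw [← adjugate_quadForm_hyperbolic_right _ (r ^ d 3 * h) v w]
    exact quadForm_adjugate_nonpos_of_trace_adjugate_neg _ hsymF hdet htype w

/-- **At a root of the top trinomial both rank-one core compressions are `≤ 0`**: `kᵀG(z)k = 0`, `k = v × w ≠ 0`. [folklore] -/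
theorem quadForm_adjugate_core_nonpos_at_top_root (d : Fin 4 → ℕ) (S : Fin 4 → Matrix (Fin 3) (Fin 3) ℝ) (hS : ∀ l, (S l).IsSymm)
    (v w : Fin 3 → ℝ) (hk : v ⨯₃ w ≠ 0) {z : ℝ}
    (hz : (v ⨯₃ w) ⬝ᵥ ((∑ l : Fin 3, z ^ d (Fin.castSucc l) • S (Fin.castSucc l)) *ᵥ (v ⨯₃ w)) = 0) :
    v ⬝ᵥ ((∑ l : Fin 3, z ^ d (Fin.castSucc l) • S (Fin.castSucc l)).adjugate *ᵥ v) ≤ 0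
      ∧ w ⬝ᵥ ((∑ l : Fin 3, z ^ d (Fin.castSucc l) • S (Fin.castSucc l)).adjugate *ᵥ w) ≤ 0 :=
  ⟨quadForm_adjugate_nonpos_of_cross_isotropic_left _ (isSymm_core_eval d S hS z) v w hk hz,
    quadForm_adjugate_nonpos_of_cross_isotropic _ (isSymm_core_eval d S hS z) v w hk hz⟩

/-- **ODD-CROSSING LAW for the sheet pencil.**  Symmetric letters, top letter `h·(vwᵀ + wvᵀ)`, `k = v × w ≠ 0`; `r` a det-root of type `(−)`,
`z` a root of the top trinomial `kᵀG(z)k`.  Then `0 ≤ q_v(r)·q_v(z)` and `0 ≤ q_w(r)·q_w(z)`: neither rank-one compression of the core changes sign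
an odd number of times between `r` and `z`. [folklore] -/
theorem hyperbolic_odd_crossing_law_pencil (d : Fin 4 → ℕ) (S : Fin 4 → Matrix (Fin 3) (Fin 3) ℝ) (hS : ∀ l, (S l).IsSymm)
    (h : ℝ) (v w : Fin 3 → ℝ) (hS3 : S 3 = h • (Matrix.vecMulVec v w + Matrix.vecMulVec w v)) (hk : v ⨯₃ w ≠ 0) {r z : ℝ}
    (hr : (Matrix.det (∑ l, ((X : ℝ[X]) ^ d l) • (S l).map C)).IsRoot r) (htype : (∑ l, r ^ d l • S l).adjugate.trace < 0)
    (hz : (v ⨯₃ w) ⬝ᵥ ((∑ l : Fin 3, z ^ d (Fin.castSucc l) • S (Fin.castSucc l)) *ᵥ (v ⨯₃ w)) = 0) :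
    0 ≤ (v ⬝ᵥ ((∑ l : Fin 3, r ^ d (Fin.castSucc l) • S (Fin.castSucc l)).adjugate *ᵥ v))
          * (v ⬝ᵥ ((∑ l : Fin 3, z ^ d (Fin.castSucc l) • S (Fin.castSucc l)).adjugate *ᵥ v))
      ∧ 0 ≤ (w ⬝ᵥ ((∑ l : Fin 3, r ^ d (Fin.castSucc l) • S (Fin.castSucc l)).adjugate *ᵥ w))
          * (w ⬝ᵥ ((∑ l : Fin 3, z ^ d (Fin.castSucc l) • S (Fin.castSucc l)).adjugate *ᵥ w)) := by
  obtain ⟨h1, h2⟩ := quadForm_adjugate_core_nonpos_of_type_neg d S hS h v w hS3 hr htype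
  obtain ⟨h3, h4⟩ := quadForm_adjugate_core_nonpos_at_top_root d S hS v w hk hz
  exact ⟨mul_nonneg_of_nonpos_of_nonpos h1 h3, mul_nonneg_of_nonpos_of_nonpos h2 h4⟩

end Summit.ValiantsHypothesis.ValiantsHypothesis.Theorems.LacunarySymmetroidMatrixDescartes.Census
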